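import Summits.QuantumFields.BalabanUV.Beta.GAN24.DiagramDecayVertices

/-!
# `BalabanUV.Beta.GAN24.DiagramDecayTorus` — binder row G-an2-4 ∕ (CONV-C), route R7 «TWO CURRENCIES», PART 132: THE DIAGRAM ALGEBRA ON THE UNIT TORUS, AND THE ONE-LOOP
# DIAGRAMS OF THE EFFECTIVE FORM WITH THEIR β-COEFFICIENT SHADOWS — UNCONDITIONALLY.  On the unit torus `idx L M 0` with the sup-distance `distK` every letter of PARTs 130 ∕ 131 is
# the β-cell's volume-uniform `sum_exp_tdist_le` (`d ≥ 2`), and polynomial weights `(1 + distK)^m` are dominated by `e^{ε·distK}` for every `ε > 0`; hence (§2) EVERY tower on the unit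
# torus obeying (CONV-C)'s two clauses ((UD) + (SR), constants free of `k` and `M`) has ALL its polynomially weighted local functionals `b_k(x) = Σ_y c_k(x,y)w(x,y)` converging at the
# geometric rate `θ` with ONE constant for ALL tori — the (AF-0r) shape `|β⁰_k − β⁰_∞| ≤ c₀θ^k` of `Beta.Assembly.LimitForm.conv` for the torus β-coefficient shadows; and (§3) for the
# EFFECTIVE FORM `Σ_k = (Q_k𝒢Q_kᴴ)⁻¹ − a·1` at `U = 1` (PART 128's unconditional END) the ONE-LOOP-SHAPED DIAGRAMS — the bubble `Σ_k ⊙ Σ_kᵀ`, the tadpole `diag Σ_k`, and the general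
# vertex-dressed two-line diagram `Γ₁(Σ_k ⊗ₖ Σ_k)Γ₂ᴴ` through any legs decaying at the tower's rate — obey BOTH clauses with ONE `(B, δ, θ = √(L⁻¹))` for every torus `M`, and their
# β-shadows converge: `‖b^M_k(x) − b^M_∞(x)‖ ≤ C·W·(√(L⁻¹))^k`, `C` free of `M`, `x`, `k` — every input a tree theorem, `d ≥ 2`, `L ≥ 2`, `a > 0`
# (unit b2b-balaban-gan24-p3, gen 53; v1)

NOT IN PRINT; OUR PROOF ([folklore] composition BY NAME: PART 130 (`twoLevelDecayRate_hadamard ∕ _kronecker ∕ _transpose ∕ _sub`, `entryDecay_hadamard ∕ _kronecker ∕ _transpose`,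
`sum_exp_pairDist_le`, `entryDecay_of_le_rate`-type monotonicity), PART 131 (`exists_limit_rowSum_weighted`, `entryDecay_vertexDress`, `twoLevelDecayRate_vertexDress`,
`entryDecay_diagonal_diag`), PART 127 (`sum_exp_distK_le`, `distK_self ∕ _nonneg ∕ _triangle`, `entryDecay_one ∕ _smul`), PART 128 (`exists_decay_inv_unitCovB`, `decayStations_inv_unitCovB`,
`entryDecay_of_le_rate`), `CTKingTowerWeights.distK_comm`; [Balaban1987RG1] (1.22) p. 264 and [King1986] Lemma 4.5 (4.38) p. 674 locate the SHAPES only; nothing printed is a hypothesis).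
HONEST FRAMING (cell contract, verbatim): «discharging `BetaPertH` makes Bałaban's UV stability UNCONDITIONAL — a real constructive-QFT result; it is NOT the
continuum limit and NOT the Clay problem.»  HONEST DEPENDENCY (verbatim): «continuum YM on T⁴ ⇐ BetaPertH ∧ nine spine estimates (0/9 proved); BetaPertH ⇐
(D1) ∧ (D4) ∧ CAP+tail; G-an2-4 gates asym, D1 and NE2/3/4.»

WHAT THIS FILE PROVES (0 sorry, 0 `def`, nothing cited; `Σ_k = (unitCovB L M a ha k)⁻¹ − a·1` on `idx L M 0`, `θ = √(L⁻¹)`):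
* §1 `one_add_pow_le_mul_exp` (`(1+u)^m ≤ max(1, m∕ε)^m·e^{εu}`, `u ≥ 0`, `ε > 0`); `sum_exp_pairDistK_le` (the pair letter on `idx × idx`, `≤ (dS)²`); `distK_legs_laws` (the cross-distance
  `D(x,(u,v)) = distK x u + distK x v` of two-line vertices satisfies PART 131's two triangle inequalities).
* §2 **`exists_limit_functional_distK`** — THE (AF-0r) SHAPE ON THE TORUS, GENERIC: `d ≥ 2`, `0 < δ`, `θ < 1`, `m : ℕ` ⟹ `∃ C ≥ 0` (depends on `(d, δ, m)` only) such that for EVERY `L`, EVERY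
  torus `M`, every tower with `TwoLevelDecayRate distK c B′ δ θ` (`B′ ≥ 0`), every site `x` and every weight `‖w x y‖ ≤ W(1 + distK x y)^m`: `b_k(x) = Σ_y c_k(x,y)w(x,y) → b_∞(x)` with
  `‖b_k(x) − b_∞(x)‖ ≤ C·B′·W·θ^k∕(1−θ)`.
* §3 THE EFFECTIVE FORM's ONE-LOOP DIAGRAMS (`L ≥ 2`, `d ≥ 2`): `decay_effForm` ((UD)+(SR) for `Σ_k` with ONE `(κ′, B_Σ, B_Σ′)` ∀ `M` — PART 128 repackaged); **`twoLevelDecayRate_bubble_effForm`**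
  (`Σ_k ⊙ Σ_kᵀ`: (UD) `(B_Σ², κ′)` and (SR) `(2B_ΣB_Σ′, κ′, θ)` — rates ADD back to `κ′`); **`twoLevelDecayRate_tadpole_effForm`**; **`twoLevelDecayRate_oneLoop_effForm`** (`Γ₁(Σ_k ⊗ₖ Σ_k)Γ₂ᴴ` for
  all legs `‖Γᵢ x (u,v)‖ ≤ γᵢe^{−(κ′∕2)(distK x u + distK x v)}`: (UD)+(SR) with `(γ₁γ₂·C, κ′∕16, θ)`, `C` free of `M`).
* §4 **`betaShadow_effForm`**, **`betaShadow_bubble_effForm`** — for every `m`: `∃ C` (free of `M`) with `‖Σ_y Π_k(x,y)w(x,y) − b_∞‖ ≤ C·W·(√(L⁻¹))^k` for `Π_k = Σ_k` resp. `Σ_k ⊙ Σ_kᵀ`, every torus,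
  every site, every weight `‖w‖ ≤ W(1 + distK)^m` — `LimitForm.conv`'s literal shape with `c₀ = C·W`, `θ = √(L⁻¹)`, UNIFORMLY IN THE VOLUME.
WHAT IT DOES NOT DO: identify any of these torus functionals with Bałaban's (1.22) (the vertices of `Π⁰_{k+1}` are row an1's dictionary; `Σ_k` is the `U = 1` effective form of the
(1.65) dictionary, not `Π⁰`); infinite volume (PART 133's socket); backgrounds ∕ `Σ̇_k`-diagrams (same algebra over PART 128 §4 ∕ PART 129 — follower); numbers for `κ′, C`.  SUPPLIER work; no
consumer of record; NEVER «G-an2-4 closed»; NOT (CONV-C), NOT D1, NOT `BetaPertH`, NOT continuum, NOT Clay.  Records: `HOME/b2b-balaban-gan24-p3/gen53/README.md`.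
-/

noncomputable section

open scoped BigOperators ComplexConjugate Matrix Matrix.Norms.L2Operator Kronecker
open Filter Topology

namespace Summit.QuantumFields.BalabanUV.Beta.GAN24.DiagramDecayTorus

open Summit.QuantumFields.BalabanUV.T4Continuum
open Summit.QuantumFields.BalabanUV.T4Continuum.BalabanAveragedTowerUnit (idx unitCovB)
open Summit.QuantumFields.BalabanUV.T4Continuum.BalabanAveragedCoercive (gammaB gammaB_pos)
open Summit.QuantumFields.BalabanUV.T4Continuum.BalabanLineAverage (CQB CQB_nonneg)
open Summit.QuantumFields.BalabanUV.T4Continuum.CTKingTowerWeights (distK distK_comm)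
open Summit.QuantumFields.BalabanUV.T4Continuum.DecayRateInterpolation (EntryDecay DecayRate TwoLevelDecayRate entryDecay_sub)
open Summit.QuantumFields.BalabanUV.Beta.GAN24.UnitLatticeDecayAlgebra (sum_exp_distK_le distK_self distK_nonneg distK_triangle entryDecay_one entryDecay_smul)
open Summit.QuantumFields.BalabanUV.Beta.GAN24.EffectiveFormDecay (entryDecay_of_le_rate exists_decay_inv_unitCovB decayStations_inv_unitCovB)
open Summit.QuantumFields.BalabanUV.Beta.GAN24.DiagramDecayAlgebra
open Summit.QuantumFields.BalabanUV.Beta.GAN24.DiagramDecayVertices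

/-! ## §1 Polynomial weights; the pair letter and the legs' cross-distance on the unit torus -/

/-- **polynomial weights are sub-exponential**: `(1 + u)^m ≤ max(1, m∕ε)^m·e^{ε·u}` for `u ≥ 0`, `ε > 0` (`1 + (ε∕m)u ≤ e^{(ε∕m)u}`). [folklore] -/
theorem one_add_pow_le_mul_exp {u ε : ℝ} (hu : 0 ≤ u) (hε : 0 < ε) (m : ℕ) : (1 + u) ^ m ≤ (max 1 (m / ε)) ^ m * Real.exp (ε * u) := by
  rcases Nat.eq_zero_or_pos m with rfl | hm
  · simp only [pow_zero, one_mul]; exact Real.one_le_exp (by positivity)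
  have hmR : (0 : ℝ) < m := by exact_mod_cast hm
  -- `1 + u ≤ max(1, m/ε)·(1 + (ε/m)u)` and `1 + (ε/m)u ≤ e^{(ε/m)u}`
  have h1 : 1 + u ≤ max 1 (m / ε) * (1 + ε / m * u) := by
    have hA : 1 ≤ max 1 ((m : ℝ) / ε) := le_max_left _ _
    have hB : u ≤ max 1 ((m : ℝ) / ε) * (ε / m * u) := by
      have : (m : ℝ) / ε * (ε / m * u) = u := by field_simp
      calc u = (m : ℝ) / ε * (ε / m * u) := this.symm
        _ ≤ max 1 ((m : ℝ) / ε) * (ε / m * u) := mul_le_mul_of_nonneg_right (le_max_right _ _) (by positivity)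
    calc 1 + u ≤ max 1 ((m : ℝ) / ε) * 1 + max 1 ((m : ℝ) / ε) * (ε / m * u) := add_le_add (by rw [mul_one]; exact hA) hB
      _ = _ := by ring
  have h2 : 1 + ε / m * u ≤ Real.exp (ε / m * u) := by have := Real.add_one_le_exp (ε / m * u); linarith
  have h3 : 1 + u ≤ max 1 (m / ε) * Real.exp (ε / m * u) := h1.trans (mul_le_mul_of_nonneg_left h2 (by positivity))
  calc (1 + u) ^ m ≤ (max 1 (m / ε) * Real.exp (ε / m * u)) ^ m := pow_le_pow_left₀ (by positivity) h3 m
    _ = (max 1 (m / ε)) ^ m * Real.exp (ε * u) := by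
        rw [mul_pow, ← Real.exp_nat_mul]; congr 2; field_simp

/-- a polynomially bounded weight is a sub-exponential weight: `‖w x y‖ ≤ W(1 + dist x y)^m` ⟹ `‖w x y‖ ≤ (W·max(1,m∕ε)^m)·e^{ε·dist x y}`. [folklore] -/
theorem weight_poly_le_exp {n : Type*} {dist : n → n → ℝ} (hd0 : ∀ x y, 0 ≤ dist x y) {w : n → n → ℂ} {W : ℝ} {m : ℕ} (hW : 0 ≤ W)
    (hw : ∀ x y, ‖w x y‖ ≤ W * (1 + dist x y) ^ m) {ε : ℝ} (hε : 0 < ε) (x y : n) :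
    ‖w x y‖ ≤ W * (max 1 (m / ε)) ^ m * Real.exp (ε * dist x y) := by
  rw [mul_assoc]
  exact (hw x y).trans (mul_le_mul_of_nonneg_left (one_add_pow_le_mul_exp (hd0 x y) hε m) hW)

section Torus

variable {d : ℕ} (L : ℕ) [NeZero L] (M : Fin d → ℕ) [hM : ∀ μ, NeZero (M μ)]

omit [NeZero L] hM in
/-- **the pair letter on the unit torus** (`d ≥ 2`, `c > 0`): with `S = S(c, d)` of `sum_exp_distK_le`, `Σ_{(u,v)} e^{−c(distK x u + distK y v)} ≤ (dS)²` for every `L, M, x, y`. [folklore] -/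
theorem sum_exp_pairDistK_le (hd : 2 ≤ d) {c : ℝ} (hc : 0 < c) :
    ∃ S : ℝ, 0 ≤ S ∧ ∀ (L : ℕ) [NeZero L] (M : Fin d → ℕ) [∀ μ, NeZero (M μ)] (p : idx L M 0 × idx L M 0),
      ∑ q : idx L M 0 × idx L M 0, Real.exp (-(c * (distK L M p.1 q.1 + distK L M p.2 q.2))) ≤ (d * S) * (d * S) := by
  obtain ⟨S, hS0, hS⟩ := sum_exp_distK_le hd hc
  exact ⟨S, hS0, fun L _ M _ p => sum_exp_pairDist_le (fun x => hS L M x) (fun u => hS L M u) p⟩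

omit [NeZero L] in
/-- the legs' cross-distance `D(x,(u,v)) = distK x u + distK x v` obeys PART 131's two triangle inequalities (and is `≥ 0`). [folklore] -/
theorem distK_legs_laws :
    (∀ (x : idx L M 0) (q r : idx L M 0 × idx L M 0),
        distK L M x r.1 + distK L M x r.2 ≤ (distK L M x q.1 + distK L M x q.2) + (distK L M q.1 r.1 + distK L M q.2 r.2)) ∧
    (∀ (x y : idx L M 0) (q : idx L M 0 × idx L M 0), distK L M x y ≤ (distK L M x q.1 + distK L M x q.2) + (distK L M y q.1 + distK L M y q.2)) ∧
    (∀ (x : idx L M 0) (q : idx L M 0 × idx L M 0), 0 ≤ distK L M x q.1 + distK L M x q.2) := by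
  refine ⟨fun x q r => ?_, fun x y q => ?_, fun x q => add_nonneg (distK_nonneg L M _ _) (distK_nonneg L M _ _)⟩
  · have h1 := distK_triangle L M x r.1 q.1
    have h2 := distK_triangle L M x r.2 q.2
    linarith
  · have h1 := distK_triangle L M x y q.1
    rw [distK_comm L M q.1 y] at h1
    have := distK_nonneg L M x q.2
    have := distK_nonneg L M y q.2
    linarith

/-! ## §2 The (AF-0r) shape for every polynomially weighted functional of every (SR) tower on the unit torus -/

omit [NeZero L] hM in
/-- **`exists_limit_functional_distK` — THE (AF-0r) SHAPE ON THE UNIT TORUS, UNIFORMLY IN THE VOLUME** [our proof] (`d ≥ 2`, `δ > 0`, `θ < 1`, `m : ℕ`): there is `C ≥ 0` depending on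
`(d, δ, m)` only such that for EVERY `L`, EVERY torus `M`, every tower `c` on `idx L M 0` with `TwoLevelDecayRate (distK L M) c B′ δ θ` and `B′ ≥ 0`, every site `x` and every weight with
`‖w x y‖ ≤ W(1 + distK x y)^m` (`W ≥ 0`), the functional `b_k(x) = Σ_y c_k(x,y)w(x,y)` converges to some `b_∞(x)` with `‖b_k(x) − b_∞(x)‖ ≤ C·B′·W·θ^k∕(1−θ)` for all `k`
(weight `≤ W·max(1,2m∕δ)^m·e^{(δ∕2)distK}`, letter at `δ − δ∕2`; PART 131's `exists_limit_rowSum_weighted`). [cite: Balaban1987RG1, (1.22) p.264 (shape of the functional)] -/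
theorem exists_limit_functional_distK (hd : 2 ≤ d) {δ θ : ℝ} (hδ : 0 < δ) (hθ1 : θ < 1) (m : ℕ) :
    ∃ C : ℝ, 0 ≤ C ∧ ∀ (L : ℕ) [NeZero L] (M : Fin d → ℕ) [∀ μ, NeZero (M μ)] (c : ℕ → Matrix (idx L M 0) (idx L M 0) ℂ) (B' : ℝ),
      0 ≤ B' → TwoLevelDecayRate (distK L M) c B' δ θ → ∀ (x : idx L M 0) (w : idx L M 0 → idx L M 0 → ℂ) (W : ℝ), 0 ≤ W →
      (∀ x y, ‖w x y‖ ≤ W * (1 + distK L M x y) ^ m) →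
      ∃ binf : ℂ, Tendsto (fun k => ∑ y, c k x y * w x y) atTop (𝓝 binf) ∧ ∀ k, ‖∑ y, c k x y * w x y - binf‖ ≤ C * B' * W * θ ^ k / (1 - θ) := by
  obtain ⟨S, hS0, hS⟩ := sum_exp_distK_le hd (half_pos hδ)
  refine ⟨(max 1 (m / (δ / 2))) ^ m * (d * S), by positivity, fun L _ M _ c B' hB' hc x w W hW hw => ?_⟩
  have hw' : ∀ x y, ‖w x y‖ ≤ W * (max 1 (m / (δ / 2))) ^ m * Real.exp (δ / 2 * distK L M x y) :=
    weight_poly_le_exp (distK_nonneg L M) hW hw (half_pos hδ)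
  have hS' : ∀ x : idx L M 0, ∑ y, Real.exp (-((δ - δ / 2) * distK L M x y)) ≤ d * S := fun x => by
    have h := hS L M x; rwa [show δ - δ / 2 = δ / 2 by ring]
  obtain ⟨binf, hlim, hbd⟩ := exists_limit_rowSum_weighted hc hθ1 hw' (by positivity) hS' x
  exact ⟨binf, hlim, fun k => (hbd k).trans (le_of_eq (by ring))⟩

/-! ## §3 The effective form's one-loop diagrams at `U = 1`: both clauses, one constant for all tori -/

variable (a : ℝ) (ha : 0 < a)

/-- **`decay_effForm` — BOTH CLAUSES FOR `Σ_k`, REPACKAGED** [our proof] (`L ≥ 2`, `d ≥ 2`): `∃ κ′ > 0, B_Σ ≥ 0, B_Σ′ ≥ 0` depending on `(d, L, a)` only with, for EVERY torus `M`,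
(UD) `∀ k, EntryDecay distK Σ_k B_Σ κ′` and (SR) `TwoLevelDecayRate distK Σ κ′ … wait` — precisely: (UD) at rate `κ′` and (SR) `TwoLevelDecayRate distK Σ B_Σ′ κ′ (√(L⁻¹))`, the SAME rate `κ′`
(PART 128's `exists_decay_inv_unitCovB` at `2κ′`, weakened, + `decayStations_inv_unitCovB`; `a·1` is level-independent and decays at every rate). -/
theorem decay_effForm (hL : 2 ≤ L) (hd : 2 ≤ d) :
    ∃ κ' Bs Bs' : ℝ, 0 < κ' ∧ 0 ≤ Bs ∧ 0 ≤ Bs' ∧ ∀ (M : Fin d → ℕ) [∀ μ, NeZero (M μ)],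
      (∀ k, EntryDecay (distK L M) ((unitCovB L M a ha k)⁻¹ - (a : ℂ) • (1 : Matrix (idx L M 0) (idx L M 0) ℂ)) Bs κ') ∧
      TwoLevelDecayRate (distK L M) (fun k => (unitCovB L M a ha k)⁻¹ - (a : ℂ) • (1 : Matrix (idx L M 0) (idx L M 0) ℂ)) Bs' κ' (Real.sqrt ((L : ℝ)⁻¹)) := by
  obtain ⟨κ', B', hκ', hB', h⟩ := decayStations_inv_unitCovB L a ha hL hd
  -- (UD) for `c_k⁻¹` at rate `κ'` from the limit decay + the limit-form rate? simpler: PART 128 §2 gives it directly at some rate; we use `h`'s own data: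
  -- `c_k⁻¹ = c_∞⁻¹ + (c_k⁻¹ − c_∞⁻¹)`, both decaying at rate `κ'/2`.
  set R : ℝ := Real.sqrt (2 * B' * (((gammaB d a)⁻¹) ^ 2 * CQB d a / (1 - (L : ℝ)⁻¹))) with hR
  set R' : ℝ := Real.sqrt (2 * B' * (2 * (((gammaB d a)⁻¹) ^ 2 * CQB d a) / (1 - (L : ℝ)⁻¹))) with hR'
  refine ⟨κ' / 2, B' + R + ‖(a : ℂ)‖ * 1, R', half_pos hκ', by positivity, Real.sqrt_nonneg _, fun M _ => ?_⟩
  obtain ⟨cinf, -, hinf, hrate, hstep⟩ := h M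
  have hθ0 : 0 ≤ Real.sqrt ((L : ℝ)⁻¹) := Real.sqrt_nonneg _
  have hθ1 : Real.sqrt ((L : ℝ)⁻¹) ≤ 1 := by
    rw [Real.sqrt_le_one]; exact inv_le_one_of_one_le₀ (by exact_mod_cast le_trans one_le_two hL)
  refine ⟨fun k => ?_, ?_⟩
  · -- `Σ_k = c_∞⁻¹ + (c_k⁻¹ − c_∞⁻¹) − a·1`
    have h1 : EntryDecay (distK L M) cinf⁻¹ B' (κ' / 2) := entryDecay_of_le_rate (distK_nonneg L M) hinf hB'.le (half_le_self hκ'.le)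
    have h2 : EntryDecay (distK L M) ((unitCovB L M a ha k)⁻¹ - cinf⁻¹) R (κ' / 2) := fun x y =>
      (hrate k x y).trans (by
        have : R * Real.sqrt ((L : ℝ)⁻¹) ^ k ≤ R * 1 := mul_le_mul_of_nonneg_left (pow_le_one₀ hθ0 hθ1) (Real.sqrt_nonneg _)
        exact mul_le_mul_of_nonneg_right (by linarith) (Real.exp_pos _).le)
    have h3 : EntryDecay (distK L M) ((a : ℂ) • (1 : Matrix (idx L M 0) (idx L M 0) ℂ)) (‖(a : ℂ)‖ * 1) (κ' / 2) :=
      entryDecay_smul (entryDecay_one (distK_self L M) (κ' / 2)) (a : ℂ)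
    have e : (unitCovB L M a ha k)⁻¹ - (a : ℂ) • (1 : Matrix (idx L M 0) (idx L M 0) ℂ)
        = (cinf⁻¹ + ((unitCovB L M a ha k)⁻¹ - cinf⁻¹)) - (a : ℂ) • (1 : Matrix (idx L M 0) (idx L M 0) ℂ) := by abel
    rw [e]
    exact entryDecay_sub (entryDecay_add h1 h2) h3
  · intro k x y
    have e : ((unitCovB L M a ha (k + 1))⁻¹ - (a : ℂ) • (1 : Matrix (idx L M 0) (idx L M 0) ℂ))
        - ((unitCovB L M a ha k)⁻¹ - (a : ℂ) • (1 : Matrix (idx L M 0) (idx L M 0) ℂ))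
        = (unitCovB L M a ha (k + 1))⁻¹ - (unitCovB L M a ha k)⁻¹ := by abel
    rw [e]
    exact hstep k x y

/-- **`twoLevelDecayRate_bubble_effForm` — THE ONE-LOOP BUBBLE OF THE EFFECTIVE FORM IN BOTH CURRENCIES, UNCONDITIONALLY** [our proof] (`L ≥ 2`, `d ≥ 2`): with the constants of
`decay_effForm`, for EVERY torus `M` the bubble `Σ_k ⊙ Σ_kᵀ` (`(x,y) ↦ Σ_k(x,y)Σ_k(y,x)`) has (UD) `(B_Σ², κ′ + κ′)` and (SR) `(B_Σ′B_Σ + B_ΣB_Σ′, κ′ + κ′, √(L⁻¹))` — parallel lines, rates add, no letter. -/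
theorem twoLevelDecayRate_bubble_effForm (hL : 2 ≤ L) (hd : 2 ≤ d) :
    ∃ κ' Bs Bs' : ℝ, 0 < κ' ∧ 0 ≤ Bs ∧ 0 ≤ Bs' ∧ ∀ (M : Fin d → ℕ) [∀ μ, NeZero (M μ)],
      (∀ k, EntryDecay (distK L M)
        (((unitCovB L M a ha k)⁻¹ - (a : ℂ) • (1 : Matrix (idx L M 0) (idx L M 0) ℂ)) ⊙ ((unitCovB L M a ha k)⁻¹ - (a : ℂ) • (1 : Matrix (idx L M 0) (idx L M 0) ℂ))ᵀ)
        (Bs * Bs) (κ' + κ')) ∧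
      TwoLevelDecayRate (distK L M)
        (fun k => ((unitCovB L M a ha k)⁻¹ - (a : ℂ) • (1 : Matrix (idx L M 0) (idx L M 0) ℂ)) ⊙ ((unitCovB L M a ha k)⁻¹ - (a : ℂ) • (1 : Matrix (idx L M 0) (idx L M 0) ℂ))ᵀ)
        (Bs' * Bs + Bs * Bs') (κ' + κ') (Real.sqrt ((L : ℝ)⁻¹)) := by
  obtain ⟨κ', Bs, Bs', hκ', hBs, hBs', h⟩ := decay_effForm L a ha hL hd
  refine ⟨κ', Bs, Bs', hκ', hBs, hBs', fun M _ => ?_⟩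
  obtain ⟨hud, hsr⟩ := h M
  have hudT : ∀ k, EntryDecay (distK L M) ((unitCovB L M a ha k)⁻¹ - (a : ℂ) • (1 : Matrix (idx L M 0) (idx L M 0) ℂ))ᵀ Bs κ' :=
    fun k => entryDecay_transpose (distK_comm L M) (hud k)
  exact ⟨fun k => entryDecay_hadamard (hud k) (hudT k), twoLevelDecayRate_hadamard hud hudT hsr (twoLevelDecayRate_transpose (distK_comm L M) hsr)⟩

/-- **`twoLevelDecayRate_tadpole_effForm` — THE TADPOLE `δ_{xy}Σ_k(x,x)` IN BOTH CURRENCIES, UNCONDITIONALLY** [our proof] (`L ≥ 2`, `d ≥ 2`): (UD) `(B_Σ, κ′)` and (SR) `(B_Σ′, κ′, √(L⁻¹))`, every torus. -/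
theorem twoLevelDecayRate_tadpole_effForm (hL : 2 ≤ L) (hd : 2 ≤ d) :
    ∃ κ' Bs Bs' : ℝ, 0 < κ' ∧ 0 ≤ Bs ∧ 0 ≤ Bs' ∧ ∀ (M : Fin d → ℕ) [∀ μ, NeZero (M μ)],
      (∀ k, EntryDecay (distK L M) (Matrix.diagonal fun x => ((unitCovB L M a ha k)⁻¹ - (a : ℂ) • (1 : Matrix (idx L M 0) (idx L M 0) ℂ)) x x) Bs κ') ∧
      TwoLevelDecayRate (distK L M) (fun k => Matrix.diagonal fun x => ((unitCovB L M a ha k)⁻¹ - (a : ℂ) • (1 : Matrix (idx L M 0) (idx L M 0) ℂ)) x x)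
        Bs' κ' (Real.sqrt ((L : ℝ)⁻¹)) := by
  obtain ⟨κ', Bs, Bs', hκ', hBs, hBs', h⟩ := decay_effForm L a ha hL hd
  refine ⟨κ', Bs, Bs', hκ', hBs, hBs', fun M _ => ?_⟩
  obtain ⟨hud, hsr⟩ := h M
  exact ⟨fun k => entryDecay_diagonal_diag (hud k), twoLevelDecayRate_diagonal_diag hsr⟩

/-- **`twoLevelDecayRate_oneLoop_effForm` — THE GENERAL VERTEX-DRESSED TWO-LINE DIAGRAM `Γ₁(Σ_k ⊗ₖ Σ_k)Γ₂ᴴ` IN BOTH CURRENCIES, UNCONDITIONALLY** [our proof] (`L ≥ 2`, `d ≥ 2`): there are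
`κ′ > 0` and `C, C′ ≥ 0` depending on `(d, L, a)` only such that for EVERY torus `M` and all legs `Γ₁, Γ₂ : idx × (idx × idx)` with `‖Γᵢ x (u,v)‖ ≤ γᵢ·e^{−κ′(distK x u + distK x v)}` (`γᵢ ≥ 0`;
finite-range legs qualify with `γᵢ = sup‖Γᵢ‖·e^{2κ′r}`): (UD) `EntryDecay distK (Γ₁(Σ_k ⊗ₖ Σ_k)Γ₂ᴴ) (γ₁γ₂C) (κ′∕4)` for all `k`, and (SR)
`TwoLevelDecayRate distK (k ↦ Γ₁(Σ_k ⊗ₖ Σ_k)Γ₂ᴴ) (γ₁γ₂C′) (κ′∕4) (√(L⁻¹))` (PART 130 §5 on the pair torus + PART 131 §1 with the pair letters of §1). -/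
theorem twoLevelDecayRate_oneLoop_effForm (hL : 2 ≤ L) (hd : 2 ≤ d) :
    ∃ κ' C C' : ℝ, 0 < κ' ∧ 0 ≤ C ∧ 0 ≤ C' ∧ ∀ (M : Fin d → ℕ) [∀ μ, NeZero (M μ)] (γ₁ γ₂ : ℝ), 0 ≤ γ₁ → 0 ≤ γ₂ →
      ∀ (Γ₁ Γ₂ : Matrix (idx L M 0) (idx L M 0 × idx L M 0) ℂ),
      (∀ x q, ‖Γ₁ x q‖ ≤ γ₁ * Real.exp (-(κ' * (distK L M x q.1 + distK L M x q.2)))) →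
      (∀ x q, ‖Γ₂ x q‖ ≤ γ₂ * Real.exp (-(κ' * (distK L M x q.1 + distK L M x q.2)))) →
      (∀ k, EntryDecay (distK L M)
        (Γ₁ * (((unitCovB L M a ha k)⁻¹ - (a : ℂ) • (1 : Matrix (idx L M 0) (idx L M 0) ℂ)) ⊗ₖ ((unitCovB L M a ha k)⁻¹ - (a : ℂ) • (1 : Matrix (idx L M 0) (idx L M 0) ℂ))) * Γ₂ᴴ)
        (γ₁ * γ₂ * C) (κ' / 4)) ∧
      TwoLevelDecayRate (distK L M)
        (fun k => Γ₁ * (((unitCovB L M a ha k)⁻¹ - (a : ℂ) • (1 : Matrix (idx L M 0) (idx L M 0) ℂ)) ⊗ₖ ((unitCovB L M a ha k)⁻¹ - (a : ℂ) • (1 : Matrix (idx L M 0) (idx L M 0) ℂ))) * Γ₂ᴴ)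
        (γ₁ * γ₂ * C') (κ' / 4) (Real.sqrt ((L : ℝ)⁻¹)) := by
  obtain ⟨κ', Bs, Bs', hκ', hBs, hBs', h⟩ := decay_effForm L a ha hL hd
  obtain ⟨S₁, hS₁0, hS₁⟩ := sum_exp_pairDistK_le (d := d) hd (half_pos hκ')
  obtain ⟨S₂, hS₂0, hS₂⟩ := sum_exp_pairDistK_le (d := d) hd (by positivity : 0 < κ' / 4)
  refine ⟨κ', Bs * Bs * ((d * S₁) * (d * S₁) * ((d * S₂) * (d * S₂))), (Bs' * Bs + Bs * Bs') * ((d * S₁) * (d * S₁) * ((d * S₂) * (d * S₂))), hκ',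
    by positivity, by positivity, fun M _ γ₁ γ₂ hγ₁ hγ₂ Γ₁ Γ₂ hΓ₁ hΓ₂ => ?_⟩
  obtain ⟨hud, hsr⟩ := h M
  obtain ⟨hDp, hDD, hD0⟩ := distK_legs_laws L M
  have hpair0 : ∀ q r : idx L M 0 × idx L M 0, 0 ≤ distK L M q.1 r.1 + distK L M q.2 r.2 := fun q r => add_nonneg (distK_nonneg L M _ _) (distK_nonneg L M _ _)
  have hK : ∀ k, EntryDecay (fun q r : idx L M 0 × idx L M 0 => distK L M q.1 r.1 + distK L M q.2 r.2)
      (((unitCovB L M a ha k)⁻¹ - (a : ℂ) • (1 : Matrix (idx L M 0) (idx L M 0) ℂ)) ⊗ₖ ((unitCovB L M a ha k)⁻¹ - (a : ℂ) • (1 : Matrix (idx L M 0) (idx L M 0) ℂ)))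
      (Bs * Bs) κ' := fun k => entryDecay_kronecker (hud k) (hud k)
  have hKr := twoLevelDecayRate_kronecker hud hud hsr hsr
  refine ⟨fun k => ?_, ?_⟩
  · have := entryDecay_vertexDress (dist := distK L M) (D := fun x (q : idx L M 0 × idx L M 0) => distK L M x q.1 + distK L M x q.2) hDp hDD hpair0 hD0 hκ'.le hγ₁ hγ₂
      (mul_nonneg hBs hBs) (fun x => hS₁ L M (x, x)) (fun x => hS₂ L M (x, x)) hΓ₁ hΓ₂ (hK k)
    exact fun x y => (this x y).trans (le_of_eq (by ring))
  · have := twoLevelDecayRate_vertexDress (dist := distK L M) (D := fun x (q : idx L M 0 × idx L M 0) => distK L M x q.1 + distK L M x q.2) hDp hDD hpair0 hD0 hκ'.le hγ₁ hγ₂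
      (by positivity : 0 ≤ Bs' * Bs + Bs * Bs') (Real.sqrt_nonneg _) (fun x => hS₁ L M (x, x)) (fun x => hS₂ L M (x, x)) hΓ₁ hΓ₂ hKr
    exact fun k x y => (this k x y).trans (le_of_eq (by ring))

/-! ## §4 The β-coefficient shadows of the effective form's diagrams: `LimitForm.conv`'s shape, uniformly in the volume -/

/-- **`betaShadow_effForm` — THE (AF-0r) SHAPE FOR EVERY POLYNOMIALLY WEIGHTED FUNCTIONAL OF THE EFFECTIVE FORM, UNIFORMLY IN THE VOLUME, UNCONDITIONALLY** [our proof] (`L ≥ 2`, `d ≥ 2`, `m : ℕ`):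
there is `C ≥ 0` depending on `(d, L, a, m)` only such that for EVERY torus `M`, every site `x` and every weight `‖w x y‖ ≤ W(1 + distK x y)^m` (`W ≥ 0`; the (1.22)-type weights `x_μx_ν` in centred
coordinates are the case `m = 2`), `b^M_k(x) = Σ_y Σ_k(x,y)w(x,y)` converges to some `b^M_∞(x)` with `‖b^M_k(x) − b^M_∞(x)‖ ≤ C·W·(√(L⁻¹))^k` for all `k` — `|β⁰_k − β⁰_∞| ≤ c₀θ^k` with `c₀ = CW`
free of `M`. [cite: Balaban1987RG1, (1.22) p.264 (shape)] -/
theorem betaShadow_effForm (hL : 2 ≤ L) (hd : 2 ≤ d) (m : ℕ) :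
    ∃ C : ℝ, 0 ≤ C ∧ ∀ (M : Fin d → ℕ) [∀ μ, NeZero (M μ)] (x : idx L M 0) (w : idx L M 0 → idx L M 0 → ℂ) (W : ℝ), 0 ≤ W →
      (∀ x y, ‖w x y‖ ≤ W * (1 + distK L M x y) ^ m) →
      ∃ binf : ℂ, Tendsto (fun k => ∑ y, ((unitCovB L M a ha k)⁻¹ - (a : ℂ) • (1 : Matrix (idx L M 0) (idx L M 0) ℂ)) x y * w x y) atTop (𝓝 binf) ∧
        ∀ k, ‖∑ y, ((unitCovB L M a ha k)⁻¹ - (a : ℂ) • (1 : Matrix (idx L M 0) (idx L M 0) ℂ)) x y * w x y - binf‖ ≤ C * W * Real.sqrt ((L : ℝ)⁻¹) ^ k := by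
  obtain ⟨κ', Bs, Bs', hκ', hBs, hBs', h⟩ := decay_effForm L a ha hL hd
  have hL1 : (1 : ℝ) < L := by exact_mod_cast (lt_of_lt_of_le one_lt_two hL : 1 < L)
  have hθ1 : Real.sqrt ((L : ℝ)⁻¹) < 1 := by
    rw [show (1 : ℝ) = Real.sqrt 1 from Real.sqrt_one.symm]
    exact Real.sqrt_lt_sqrt (inv_nonneg.mpr (Nat.cast_nonneg _)) (inv_lt_one_of_one_lt₀ hL1)
  obtain ⟨C, hC0, hC⟩ := exists_limit_functional_distK (d := d) hd hκ' hθ1 m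
  refine ⟨C * Bs' / (1 - Real.sqrt ((L : ℝ)⁻¹)), by have := sub_pos.mpr hθ1; positivity, fun M _ x w W hW hw => ?_⟩
  obtain ⟨binf, hlim, hbd⟩ := hC L M _ Bs' hBs' (h M).2 x w W hW hw
  exact ⟨binf, hlim, fun k => (hbd k).trans (le_of_eq (by ring))⟩

/-- **`betaShadow_bubble_effForm` — THE SAME FOR THE ONE-LOOP BUBBLE `Σ_k ⊙ Σ_kᵀ`** [our proof] (`L ≥ 2`, `d ≥ 2`, `m : ℕ`): `∃ C ≥ 0` (free of `M`) with
`‖Σ_y Σ_k(x,y)Σ_k(y,x)w(x,y) − b^M_∞(x)‖ ≤ C·W·(√(L⁻¹))^k` for every torus, site, `k` and weight `‖w‖ ≤ W(1 + distK)^m`. [cite: Balaban1987RG1, (1.22) p.264 (shape)] -/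
theorem betaShadow_bubble_effForm (hL : 2 ≤ L) (hd : 2 ≤ d) (m : ℕ) :
    ∃ C : ℝ, 0 ≤ C ∧ ∀ (M : Fin d → ℕ) [∀ μ, NeZero (M μ)] (x : idx L M 0) (w : idx L M 0 → idx L M 0 → ℂ) (W : ℝ), 0 ≤ W →
      (∀ x y, ‖w x y‖ ≤ W * (1 + distK L M x y) ^ m) →
      ∃ binf : ℂ, Tendsto (fun k => ∑ y, (((unitCovB L M a ha k)⁻¹ - (a : ℂ) • (1 : Matrix (idx L M 0) (idx L M 0) ℂ)) ⊙
          ((unitCovB L M a ha k)⁻¹ - (a : ℂ) • (1 : Matrix (idx L M 0) (idx L M 0) ℂ))ᵀ) x y * w x y) atTop (𝓝 binf) ∧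
        ∀ k, ‖∑ y, (((unitCovB L M a ha k)⁻¹ - (a : ℂ) • (1 : Matrix (idx L M 0) (idx L M 0) ℂ)) ⊙
          ((unitCovB L M a ha k)⁻¹ - (a : ℂ) • (1 : Matrix (idx L M 0) (idx L M 0) ℂ))ᵀ) x y * w x y - binf‖ ≤ C * W * Real.sqrt ((L : ℝ)⁻¹) ^ k := by
  obtain ⟨κ', Bs, Bs', hκ', hBs, hBs', h⟩ := twoLevelDecayRate_bubble_effForm L a ha hL hd
  have hL1 : (1 : ℝ) < L := by exact_mod_cast (lt_of_lt_of_le one_lt_two hL : 1 < L)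
  have hθ1 : Real.sqrt ((L : ℝ)⁻¹) < 1 := by
    rw [show (1 : ℝ) = Real.sqrt 1 from Real.sqrt_one.symm]
    exact Real.sqrt_lt_sqrt (inv_nonneg.mpr (Nat.cast_nonneg _)) (inv_lt_one_of_one_lt₀ hL1)
  obtain ⟨C, hC0, hC⟩ := exists_limit_functional_distK (d := d) hd (by positivity : 0 < κ' + κ') hθ1 m
  refine ⟨C * (Bs' * Bs + Bs * Bs') / (1 - Real.sqrt ((L : ℝ)⁻¹)), by have := sub_pos.mpr hθ1; positivity, fun M _ x w W hW hw => ?_⟩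
  obtain ⟨binf, hlim, hbd⟩ := hC L M _ (Bs' * Bs + Bs * Bs') (by positivity) (h M).2 x w W hW hw
  exact ⟨binf, hlim, fun k => (hbd k).trans (le_of_eq (by ring))⟩

end Torus

end Summit.QuantumFields.BalabanUV.Beta.GAN24.DiagramDecayTorus

end
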